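/-
Copyright (c) 2026 the pub-hodgecm-mathlib formalisation cell (harness21).  Prover seat hodgecm-mathlib-A-p19 (g27), 2026-09-02.  Road «S3-tree»∕«S3-ram» (LEAD F0P3a-plan (g12)
T11-41∕T11-52; owner p06 (g15)), row (e2) «P-2-ram», organ «(D2-β)-ram, part T AT THE PLACE: THE TRANSLATION THEOREMS FOR BOTH TORUS TYPES AT A TAME-RAMIFIED QUADRATIC PLACE» —
★ `UnramifiedQuadraticNormTransferTypeA` ∕ ★ `…TypeB` with every base hypothesis discharged by ★ `RamifiedPlaceNormDictionary` (part D) and ★ `UnramifiedQuadraticDictionaryNorms` (part N).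
-/
import Literature.NumberTheory.NumberFields.UnramifiedQuadraticNormTransferTypeA   -- ★ part T type A (this seat); brings parts T₀, N, L
import Literature.NumberTheory.NumberFields.UnramifiedQuadraticNormTransferTypeB   -- ★ p847290 part T type B (this seat)
import Literature.NumberTheory.LocalFields.RamifiedPlaceNormDictionary             -- ★ part D (this seat): the base dictionary at a ramified place; brings ★ p846833, ★ anti-fixed uniformiser
import HarnessLib

/-!
# The translation theorems `y ∈ N_{σ_K}(K^×) ⟺ y·ι′y ∈ ι₁N(L_w^×)` for both CM torus types at a TAME-RAMIFIED place, base hypotheses discharged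
# (Serre, *Local Fields* V §3 Cor. 2, XIV §4; Neukirch V (1.2))

Topic `NumberTheory/NumberFields`; namespace `Literature.NumberTheory.NumberFields`.  THEOREMS ONLY (no definition, no instance, no notation, no named fact, no `sorry`); kernel lane
`--supports stmt-HodgeConjecture-24833`.  Cell `pub/hodgecm-mathlib` (D-0151), crux H413; road «S3-tree», seeding wave «S3-ram», row (e2) «P-2-ram»; organ **«(D2-β)-ram, part T at the
place»** (this seat).  Frame: `F ∕ F₀` a quadratic extension of number fields with non-trivial automorphism `c` (the CM extension `L ∕ L⁺` and complex conjugation), `w₀ ∣ v₀` a place of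
`F` fixed by `c`, RAMIFIED (`e(w₀|v₀) ≠ 1`) and TAME (`|2|_{w₀} = 1`), `σ := σ_{w₀} = galAdicCompletionMap c hw₀` on `F_{w₀}` (= `L_w`); `E ∕ F` a further extension with a place `w ∣ w₀`
(the eigen-field `M = L·K₂` and `W ∣ w`), `K := E_w`, `ι₁ := toPlace w₀.1 w`; `d ∈ F_{w₀}` a `σ`-FIXED UNIT WITH NON-SQUARE RESIDUE (`hdres`), `θ ∈ K` with `θ² = ι₁ d` and the
unramified coordinates (`hval`, `hcoord` — ★ `UnramifiedQuadraticDictionary` (L1′)), and the two involutions `s̃` (over `σ`, `s̃θ = θ`) and `ι′` (over `id`, `ι′θ = −θ`) of ★ (L2′), taken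
as BINDERS with their properties (the consumer ★-to-be (D5)-ram ∕ (α₂) holds them in this shape).

* **`exists_norm_iff_exists_rational_norm_typeA_of_ramified`** (torus type A, `σ_K = s̃`): for `y ∈ K^×` with `s̃y = y`,
  `(∃ b, b·s̃b·y = 1) ↔ ∃ a, ι′a = a ∧ a·s̃a·(y·ι′y) = 1`.
* **`exists_norm_comp_iff_exists_rational_norm_typeB_of_ramified`** (torus type B, `σ_K = s̃ ∘ ι′`): the same with `s̃ι′` for `s̃`.
These are the `htrans` binder of ★ `SymmetricEigenframe.exists_norm_symmCriterion_iff_exists_rational_norm` (★ p847219) at a ramified CM place, for both types: the base hypotheses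
of ★ `…TypeA` ∕ ★ `…TypeB` (`hsres hsd hdv hdres hsqF hU1F hϖ0 hsϖ hvalF` ∕ `hss hsd hd0 hnormF hprinc hdnn hfixval hantisq hηn hnK`) are supplied by ★ `RamifiedPlaceNormDictionary`
(with `η := d`), ★ `valued_galAdicCompletionMap_sub_lt_one_of_ramified`, ★ `exists_uniformizer_galAdicCompletionMap_eq_neg_of_ramified`, ★ `UnramifiedQuadraticDictionaryNorms`
(`hηn`, `hnK` for type B), and — for `hantisq` — the value group `|K^×| = |ϖ|^ℤ` read off the coordinates.  HONEST LABEL: HC_CM is proved only modulo the 2 remaining named inputs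
(hLiu418 24832, h413 24833) until rung 0 closes; local algebra, count-neutral.

## References
* [SerreLocalFields1979] J.-P. Serre, *Local Fields*, GTM 67 (1979): Ch. V §2 Prop. 3, §3 Prop. 5 and Cor. 2; Ch. XIV §4.
* [Neukirch1999] J. Neukirch, *Algebraic Number Theory*, Grundlehren 322 (1999): Ch. V (1.2); Ch. II (4.3).
-/

set_option autoImplicit false

noncomputable section

open NumberField IsDedekindDomain Polynomial
open scoped ValuativeRel
open Literature.NumberTheory.Automorphic Literature.NumberTheory.Automorphic.UnitaryGroup Literature.NumberTheory.LocalFields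
open Literature.NumberTheory.LocalFields.RamifiedPlaceNormDictionary
open Literature.NumberTheory.Automorphic.Liu2021.LemD1IndexedNonVacuityRamifiedConverse (valued_galAdicCompletionMap_sub_lt_one_of_ramified)

namespace Literature.NumberTheory.NumberFields

variable {F₀ F : Type} (E : Type) [Field F₀] [NumberField F₀] [Field F] [NumberField F] [Field E] [NumberField E]
  [Algebra F₀ F] [Algebra.IsQuadraticExtension F₀ F] [Algebra F E]
  (c : F ≃ₐ[F₀] F) (hc : c ≠ 1) (v₀ : HeightOneSpectrum (𝓞 F₀)) (w₀ : PlacesOver F v₀) (hw₀ : c • w₀.1 = w₀.1) (w : PlacesOver E w₀.1)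

include hc in
/-- **THE TRANSLATION THEOREM AT A TAME-RAMIFIED PLACE, TORUS TYPE A** (`σ_K = s̃`): ★ `exists_norm_iff_exists_rational_norm_typeA` with its base hypotheses discharged at
`(F_{w₀}, σ_{w₀}, d, ϖ)` by ★ `RamifiedPlaceNormDictionary` and ★ `exists_uniformizer_galAdicCompletionMap_eq_neg_of_ramified`.
[cite: SerreLocalFields1979, Ch. V §3 Cor. 2; Ch. XIV §4] [cite: Neukirch1999, Ch. V (1.2)] -/
theorem exists_norm_iff_exists_rational_norm_typeA_of_ramified (he : v₀.asIdeal.ramificationIdx' w₀.1.asIdeal ≠ 1)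
    (h2 : Valued.v (2 : w₀.1.adicCompletion F) = 1)
    {d : w₀.1.adicCompletion F} (hσd : galAdicCompletionMap (L := F) c hw₀ d = d) (hd1 : Valued.v d = 1)
    (hdres : ∀ r : w₀.1.adicCompletion F, Valued.v r ≤ 1 → ¬ Valued.v (d - r ^ 2) < 1)
    {θ : w.1.adicCompletion E} (hθ : θ ^ 2 = toPlace w₀.1 w d)
    (hval : ∀ p q : w₀.1.adicCompletion F, Valued.v (toPlace w₀.1 w p + toPlace w₀.1 w q * θ) = max (Valued.v p) (Valued.v q))
    (hcoord : ∀ z : w.1.adicCompletion E, ∃ pq : w₀.1.adicCompletion F × w₀.1.adicCompletion F, z = toPlace w₀.1 w pq.1 + toPlace w₀.1 w pq.2 * θ)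
    (s' ι' : w.1.adicCompletion E →+* w.1.adicCompletion E)
    (hs' : ∀ x, s' (toPlace w₀.1 w x) = toPlace w₀.1 w (galAdicCompletionMap (L := F) c hw₀ x)) (hs'θ : s' θ = θ)
    (hs's' : ∀ z, s' (s' z) = z) (hs'v : ∀ z, Valued.v (s' z) = Valued.v z)
    (hι' : ∀ x, ι' (toPlace w₀.1 w x) = toPlace w₀.1 w x) (hι'θ : ι' θ = -θ) (hι'v : ∀ z, Valued.v (ι' z) = Valued.v z)
    (hfix : ∀ z : w.1.adicCompletion E, ι' z = z → ∃ x, toPlace w₀.1 w x = z)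
    (y : w.1.adicCompletion E) (hy : y ≠ 0) (hσy : s' y = y) :
    (∃ b : w.1.adicCompletion E, b * s' b * y = 1) ↔
      ∃ a : w.1.adicCompletion E, ι' a = a ∧ a * s' a * (y * ι' y) = 1 := by
  -- the residue of `d` is a non-square
  have hdns : ¬ IsSquare (IsLocalRing.residue 𝒪[w₀.1.adicCompletion F] ⟨d, (v_le_one_iff_mem_integer d).1 hd1.le⟩) := fun h => by
    obtain ⟨r, hr, hdr⟩ := (isSquare_residue_iff_exists_valued_sub_sq_lt_one F v₀ w₀ hd1).1 h
    exact hdres r hr hdr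
  -- the anti-fixed uniformiser
  obtain ⟨ϖ, hϖ, hσϖ⟩ := exists_uniformizer_galAdicCompletionMap_eq_neg_of_ramified F c hc w₀ hw₀ he h2
  have hϖ0 : (ϖ : w₀.1.adicCompletion F) ≠ 0 := ϖ.ne_zero
  exact exists_norm_iff_exists_rational_norm_typeA E w₀.1 w h2 (galAdicCompletionMap (L := F) c hw₀)
    (fun x hx => valued_galAdicCompletionMap_sub_lt_one_of_ramified F c v₀ hc w₀ hw₀ he x hx) hσd hd1 hdres
    (exists_valued_sub_sq_lt_one_or_of_ramified F c hc v₀ w₀ hw₀ he h2 hd1 hσd hdns)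
    (fun g hg1 hσg => exists_mul_galAdicCompletionMap_eq_iff_exists_valued_sub_sq_lt_one_of_ramified F c hc v₀ w₀ hw₀ he h2 hg1 hσg)
    hϖ0 hσϖ (fun p hp0 hσp => exists_valued_eq_zpow_two_mul_of_galAdicCompletionMap_eq_of_ramified F c hc v₀ w₀ hw₀ he h2 hϖ hσϖ hp0 hσp)
    hθ hval hcoord s' ι' hs' hs'θ hs's' hs'v hι' hι'θ hι'v hfix y hy hσy

include hc in
/-- **THE TRANSLATION THEOREM AT A TAME-RAMIFIED PLACE, TORUS TYPE B** (`σ_K = s̃ ∘ ι′`): ★ `exists_norm_comp_iff_exists_rational_norm_typeB` with its base hypotheses discharged at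
`(F_{w₀}, σ_{w₀}, d, ϖ)` by ★ `RamifiedPlaceNormDictionary` (`hnormF hprinc hdnn hfixval`), the value group of the unramified `K` (`hantisq`) and ★ `UnramifiedQuadraticDictionaryNorms`
(`hηn`, `hnK`). [cite: SerreLocalFields1979, Ch. V §2 Prop. 3, §3 Cor. 2; Ch. XIV §4] [cite: Neukirch1999, Ch. V (1.2)] -/
theorem exists_norm_comp_iff_exists_rational_norm_typeB_of_ramified (he : v₀.asIdeal.ramificationIdx' w₀.1.asIdeal ≠ 1)
    (h2 : Valued.v (2 : w₀.1.adicCompletion F) = 1)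
    {d : w₀.1.adicCompletion F} (hσd : galAdicCompletionMap (L := F) c hw₀ d = d) (hd1 : Valued.v d = 1)
    (hdres : ∀ r : w₀.1.adicCompletion F, Valued.v r ≤ 1 → ¬ Valued.v (d - r ^ 2) < 1)
    {θ : w.1.adicCompletion E} (hθ : θ ^ 2 = toPlace w₀.1 w d)
    (hval : ∀ p q : w₀.1.adicCompletion F, Valued.v (toPlace w₀.1 w p + toPlace w₀.1 w q * θ) = max (Valued.v p) (Valued.v q))
    (hcoord : ∀ z : w.1.adicCompletion E, ∃ pq : w₀.1.adicCompletion F × w₀.1.adicCompletion F, z = toPlace w₀.1 w pq.1 + toPlace w₀.1 w pq.2 * θ)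
    (s' ι' : w.1.adicCompletion E →+* w.1.adicCompletion E)
    (hs' : ∀ x, s' (toPlace w₀.1 w x) = toPlace w₀.1 w (galAdicCompletionMap (L := F) c hw₀ x)) (hs'θ : s' θ = θ)
    (hs's' : ∀ z, s' (s' z) = z) (hs'v : ∀ z, Valued.v (s' z) = Valued.v z)
    (hι' : ∀ x, ι' (toPlace w₀.1 w x) = toPlace w₀.1 w x) (hι'θ : ι' θ = -θ) (hι'ι' : ∀ z, ι' (ι' z) = z) (hι'v : ∀ z, Valued.v (ι' z) = Valued.v z)
    (hcomm : ∀ z, s' (ι' z) = ι' (s' z))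
    (hfix : ∀ z : w.1.adicCompletion E, ι' z = z → ∃ x, toPlace w₀.1 w x = z)
    (y : w.1.adicCompletion E) (hy : y ≠ 0) (hσy : (s'.comp ι') y = y) :
    (∃ b : w.1.adicCompletion E, b * (s'.comp ι') b * y = 1) ↔
      ∃ a : w.1.adicCompletion E, ι' a = a ∧ a * (s'.comp ι') a * (y * ι' y) = 1 := by
  have hιv : ∀ x, Valued.v (toPlace w₀.1 w x) = Valued.v x := fun x => by
    have h := hval x 0
    rwa [map_zero, zero_mul, add_zero, map_zero, max_eq_left zero_le] at h
  have hθv : Valued.v θ = 1 := by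
    have h := hval 0 1
    rwa [map_zero, map_one, zero_add, one_mul, map_zero, map_one, max_eq_right zero_le] at h
  have h2K : Valued.v (2 : w.1.adicCompletion E) = 1 := by rw [← map_ofNat (toPlace w₀.1 w) 2, hιv]; exact h2
  have hσσ : ∀ x, galAdicCompletionMap (L := F) c hw₀ (galAdicCompletionMap (L := F) c hw₀ x) = x := fun x =>
    galAdicCompletionMap_galAdicCompletionMap_of_smul_eq c w₀ hc hw₀ x
  have hd0 : d ≠ 0 := fun h => by rw [h, map_zero] at hd1; exact zero_ne_one hd1
  -- the residue of `d` is a non-square; the anti-fixed uniformiser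
  have hdns : ¬ IsSquare (IsLocalRing.residue 𝒪[w₀.1.adicCompletion F] ⟨d, (v_le_one_iff_mem_integer d).1 hd1.le⟩) := fun h => by
    obtain ⟨r, hr, hdr⟩ := (isSquare_residue_iff_exists_valued_sub_sq_lt_one F v₀ w₀ hd1).1 h
    exact hdres r hr hdr
  obtain ⟨ϖ, hϖ, hσϖ⟩ := exists_uniformizer_galAdicCompletionMap_eq_neg_of_ramified F c hc w₀ hw₀ he h2
  have hϖ0 : (ϖ : w₀.1.adicCompletion F) ≠ 0 := ϖ.ne_zero
  -- uniqueness of the coordinates (from `hval`)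
  have huniq : ∀ z : w.1.adicCompletion E, ∃! pq : w₀.1.adicCompletion F × w₀.1.adicCompletion F, z = toPlace w₀.1 w pq.1 + toPlace w₀.1 w pq.2 * θ := by
    intro z
    obtain ⟨pq, hpq⟩ := hcoord z
    refine ⟨pq, hpq, fun pq' hpq' => ?_⟩
    have h0 : toPlace w₀.1 w (pq'.1 - pq.1) + toPlace w₀.1 w (pq'.2 - pq.2) * θ = 0 := by
      rw [map_sub, map_sub]; linear_combination hpq'.symm.trans hpq
    have hm := hval (pq'.1 - pq.1) (pq'.2 - pq.2)
    rw [h0, map_zero] at hm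
    have hp : Valued.v (pq'.1 - pq.1) = 0 := le_antisymm (hm.symm ▸ le_max_left _ _) zero_le
    have hq : Valued.v (pq'.2 - pq.2) = 0 := le_antisymm (hm.symm ▸ le_max_right _ _) zero_le
    exact Prod.ext (sub_eq_zero.1 ((Valuation.zero_iff _).1 hp)) (sub_eq_zero.1 ((Valuation.zero_iff _).1 hq))
  -- integrality of `s̃`, `ι′` from the isometries
  have hs'O : ∀ z : 𝒪[w.1.adicCompletion E], s' z ∈ 𝒪[w.1.adicCompletion E] := fun z =>
    (v_le_one_iff_mem_integer _).1 (by rw [hs'v]; exact (v_le_one_iff_mem_integer (z : w.1.adicCompletion E)).2 z.2)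
  have hι'O : ∀ z : 𝒪[w.1.adicCompletion E], ι' z ∈ 𝒪[w.1.adicCompletion E] := fun z =>
    (v_le_one_iff_mem_integer _).1 (by rw [hι'v]; exact (v_le_one_iff_mem_integer (z : w.1.adicCompletion E)).2 z.2)
  -- `hantisq`: `|K^×| = |ϖ|^ℤ` (coordinates) versus the odd order of an anti-fixed `q`
  have hgen : ∀ x : w₀.1.adicCompletion F, x ≠ 0 → ∃ n : ℤ, Valued.v x = Valued.v (ϖ : w₀.1.adicCompletion F) ^ n := fun x hx => by
    have hvx0 : Valued.v x ≠ 0 := (Valuation.ne_zero_iff _).2 hx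
    refine ⟨-WithZero.log (Valued.v x), ?_⟩
    rw [hϖ, ← WithZero.exp_zsmul, smul_eq_mul]
    conv_lhs => rw [← WithZero.exp_log hvx0]
    congr 1; ring
  have hantisq : ∀ q : w₀.1.adicCompletion F, q ≠ 0 → galAdicCompletionMap (L := F) c hw₀ q = -q →
      ∀ z : w.1.adicCompletion E, Valued.v z ^ 2 ≠ Valued.v (toPlace w₀.1 w q) := by
    intro q hq0 hσq z h
    obtain ⟨k, hk⟩ := exists_valued_eq_zpow_two_mul_add_one_of_galAdicCompletionMap_eq_neg_of_ramified F c hc v₀ w₀ hw₀ he h2 hϖ hq0 hσq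
    rw [hιv, hk] at h
    obtain ⟨⟨p', q'⟩, rfl⟩ := hcoord z
    rw [hval] at h
    -- `max |p'| |q'|` is `0` or `|ϖ|^n`
    have hx : ∃ x : w₀.1.adicCompletion F, max (Valued.v p') (Valued.v q') = Valued.v x := by
      rcases max_choice (Valued.v p') (Valued.v q') with hm | hm
      · exact ⟨p', hm⟩
      · exact ⟨q', hm⟩
    obtain ⟨x, hxe⟩ := hx
    rw [hxe] at h
    by_cases hx0 : x = 0
    · rw [hx0, map_zero, zero_pow two_ne_zero] at h
      exact (zpow_ne_zero _ ((Valuation.ne_zero_iff _).2 hϖ0)) h.symm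
    · obtain ⟨n, hn⟩ := hgen x hx0
      rw [hn, ← zpow_natCast, ← zpow_mul, hϖ, ← WithZero.exp_zsmul, ← WithZero.exp_zsmul, smul_eq_mul, smul_eq_mul] at h
      have h' := WithZero.exp_injective h
      omega
  exact exists_norm_comp_iff_exists_rational_norm_typeB E w₀.1 w (galAdicCompletionMap (L := F) c hw₀) hσσ hσd hd0
    (exists_mul_galAdicCompletionMap_mul_eq_one_or_eq_of_ramified F c hc v₀ w₀ hw₀ he h2 hd1 hσd hdns hϖ hσϖ)
    (fun x hσx hx => exists_mul_galAdicCompletionMap_eq_of_valued_sub_one_lt_one_of_ramified F c hc v₀ w₀ hw₀ he h2 hσx hx)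
    (fun ⟨z, hz⟩ => by
      obtain ⟨r, hr, hdr⟩ := (exists_mul_galAdicCompletionMap_eq_iff_exists_valued_sub_sq_lt_one_of_ramified F c hc v₀ w₀ hw₀ he h2 hd1 hσd).1 ⟨z, hz⟩
      exact hdres r hr hdr)
    (fun p q hp0 hq0 hσp hσq => valued_ne_of_galAdicCompletionMap_eq_of_eq_neg_of_ramified F c hc v₀ w₀ hw₀ he h2 hϖ hσϖ hp0 hq0 hσp hσq)
    hantisq hθ hval huniq s' ι' hs' hs'θ hι' hι'θ hs'v hι'v hfix
    (exists_mul_map_comp_eq_toPlace E w₀.1 w h2K hθv (by rw [hιv]; exact hd1) (galAdicCompletionMap (L := F) c hw₀) hσd s' ι' hs' hs'θ hs's' hs'O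
      hι' hι'θ hι'ι' hι'O hcomm)
    (fun u hu hσu => exists_mul_map_comp_eq_of_fixed_unit_typeB E w₀.1 w h2K hθv s' ι' hs'θ hs's' hs'O hι'θ hι'ι' hι'O hcomm
      ⟨u, (v_le_one_iff_mem_integer u).1 hu.le⟩ hu hσu)
    y hy hσy

end Literature.NumberTheory.NumberFields

end
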